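import Summits.BirchSwinnertonDyer.Rank1Residual.Supersingular.SignedRankZero
import HarnessLib

/-!
# The blind-point LEVER: one divisibility plus a value certificate at ONE interior point of the disc is an equality of
# characteristic ideals; assembly `⇒ BSD(E,2)` in analytic rank 0 over the tree's `SignedDatum W 2`
# (cell `b2b-bsdres`, O1 sub-cell `p = 2`; lens-1 GEN 9 rider 9c-i packet, ported by cc-typer-4 GEN 6 as typer item (27″))

HONEST FRAMING (run/shared/lean/b2b/bsd-rank1-residual/, verbatim in every file): the goal of the cell is to DELETE
the COMBINATION-SHAPED residual classes of the Birch–Swinnerton-Dyer formula for ALL analytic-rank `≤ 1` elliptic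
curves over `ℚ` — "full BSD formula for every rank `≤ 1` curve in class `C`" assembled STRICTLY from published
theorems — so that the rank-`≤ 1` remainder becomes exactly the CONSTRUCTION-SHAPED classes, which are TYPED
(missing-input `Prop`s), NOT attempted. This is not "finishing BSD". §§1–2 are pure commutative algebra over
`ℤ_p⟦T⟧` (ONE auxiliary definition `BlindLever.evalAt`, theorems); §3 is a COMPOSITION of tree theorems over the
sign-agnostic `SignedDatum W 2` (`Supersingular/SignedRankZero.lean`, p206397) with EVERY input an explicit hypothesis —
nothing about any curve, Selmer group or `L`-function is asserted; nothing booked; no RESIDUAL-MAP mark moves. This is a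
research-route packaging (R-L1-G9-α "T2-ONLY DOOR", `cells/o1/ROUTES-O1.md` §lens-1 GEN 9 rider 9c; o1 lead R-G22.1 (e):
typer item (27″), OPTIONAL S, refuter v12a §81 "9c LEVER + ASSEMBLY: PASS on shape"): the door's UNPRINTED inputs are
unchanged in number — one signed divisibility at `2` (D1-type), the readings (K)/(P), and the blind certificate (α3) =
a 2-descent quantity over `ℚ(√2)`, NOT typed here.

CREDIT. This file is the o1 lens-1 GEN 9 packet `HOME/b2b-bsdres-o1-idea-1-g9/lean/G9_BlindLever.lean`
(planner-b2b-bsdres-o1-idea-1-g9-0, 2026-08-21T15:20Z; source sha16 `c77cb041e1b59420`), ported VERBATIM up to this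
paragraph and the sub-namespace (`LensOneG9` ↦ `BlindLever`, which scopes the auxiliary `evalAt`), per the one-writer
rule (o1 lead C161 / R-G22.1 (e)).

THE LEVER (refuter v11 §64 'PASS-SHARPENED', routes R-L1-G7-C / R-L1-G9-α): let `L ∣ ξ` in `Λ = ℤ_p⟦T⟧` (ONE
divisibility of a main conjecture) and let `t ∈ ℤ_p` with `‖t‖ < 1` be a point of the open disc (the blind point
`t = −2` at `p = 2`; the classical point `t = 0`).  If the values at `t` have the same norm and are non-zero,
`‖ξ(t)‖ = ‖L(t)‖ ≠ 0` (a CERTIFICATE: `‖ξ(−2)‖⁻¹ = #X/(T+2)X` by the structure theorem, `L(−2)` an explicit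
classical number by packet B `Supersingular/BlindPointSharpTwo.lean`), then `(ξ) = (L)` as ideals of `Λ` — the FULL
main conjecture for that pair, from which the `T = 0` reading follows.  Proof: `ξ = L·h`, values multiply (`evalAt_mul`),
so `‖h(t)‖ = 1`; but `h(t) ≡ h(0) (mod t)` (`norm_evalAt_sub_constantCoeff_lt_one`), so `h(0) ∈ ℤ_p^×`, so `h ∈ Λ^×`.

§3 ASSEMBLY OVER THE TREE'S SIGN-AGNOSTIC `SignedDatum W 2`: ONE divisibility (either side) + the blind certificate at
`t = −2` ⇒ BOTH divisibilities ⇒ (with the tree's rank-0 readings (K), (P), `2 ∤ c`, `E[2]` irreducible, GZK)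
`MissingLowerBoundAt W 2 ∧ MissingUpperBoundAt W 2` ⇒ `BSDp W 2`: `bsdp_two_of_oneDivisibility_of_blindCertificate`.
WHICH SIGN at `p = 2` — NAMED EXPLICITLY per lens-1 rider 9e / refuter v12a §81 (ii) / o1 lead R-G22.1 (e): by Sprung,
ANT 11 (2017), table after Cor. 4.11 [corpus:paper:arxiv-1601.00010 p0017], at the TRIVIAL character the ♯-constant
`c♯ = L♯(0)/[0]⁺ = −a³ + 2a² + 3a − 4 ∈ {2, 6, −4}` is EVEN for every `a₂ ∈ {2, −2, 0}` while the ♭-constant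
`c♭ = −a² + 2a + 1 ∈ {1, −7, 1}` is ODD — so the hypothesis `2 ∤ c` of the tree chain (and of §3) is met by the **♭-PAIR
ONLY**; the ♯-package with its even constant is INCONSISTENT with (K) + (P) + IMC-equality + BSD₂ (rider 9e,
`sharpPackage_inconsistent`, to be typed as (27‴) after the refuter's shape audit). The ♭-function is usable at the
blind point because of the GEN 9b derivation `5·L♭(−2) = −a₂·L♯(−2)` (`w₈ = +1`, `a₂ = ±2`: `L♭(−2) ≠ 0` is
classical); at `a₂ = 0` the ♭-door is shut (`L♭(−2) = 0`) and the ♯-door needs a `2²`-corrected Euler characteristic —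
recorded, not typed. NOTE ON `hL` (refuter v12a §81): `hL : W.entireLFunction 1 ≠ 0` restricts §3 to ANALYTIC RANK 0.
-/

set_option autoImplicit false

open PowerSeries

namespace Summit.BirchSwinnertonDyer.Rank1Residual.Supersingular

namespace BlindLever

variable {p : ℕ} [Fact p.Prime]

/-- Evaluation of `g ∈ ℤ_p⟦T⟧` at a point `t` of the open unit disc: `g(t) = Σ_k g_k t^k`. [folklore] -/
noncomputable def evalAt (t : ℤ_[p]) (g : PowerSeries ℤ_[p]) : ℤ_[p] :=
  ∑' k, coeff k g * t ^ k

/-- `‖c·t^k‖ ≤ ‖t‖^k` for `p`-adic integers. [folklore] -/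
theorem norm_mul_pow_le (c t : ℤ_[p]) (k : ℕ) : ‖c * t ^ k‖ ≤ ‖t‖ ^ k :=
  calc ‖c * t ^ k‖ ≤ ‖c‖ * ‖t ^ k‖ := norm_mul_le _ _
    _ ≤ 1 * ‖t‖ ^ k := by
        gcongr
        · exact PadicInt.norm_le_one _
        · exact norm_pow_le t k
    _ = ‖t‖ ^ k := one_mul _

/-- `Σ c_k t^k` converges on the open unit disc of `ℤ_p`. [folklore] -/
theorem summable_mul_pow {t : ℤ_[p]} (ht : ‖t‖ < 1) (c : ℕ → ℤ_[p]) : Summable fun k ↦ c k * t ^ k :=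
  Summable.of_norm (Summable.of_nonneg_of_le (fun _ ↦ norm_nonneg _) (fun k ↦ norm_mul_pow_le (c k) t k)
    (summable_geometric_of_lt_one (norm_nonneg t) ht))

/-- The series of norms `‖g_k t^k‖` is summable for `‖t‖ < 1`. [folklore] -/
theorem summable_norm_coeff_mul_pow {t : ℤ_[p]} (ht : ‖t‖ < 1) (g : PowerSeries ℤ_[p]) :
    Summable fun k ↦ ‖coeff k g * t ^ k‖ :=
  Summable.of_nonneg_of_le (fun _ ↦ norm_nonneg _) (fun k ↦ norm_mul_pow_le (coeff k g) t k)
    (summable_geometric_of_lt_one (norm_nonneg t) ht)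

/-- `Σ g_k t^k` converges for `‖t‖ < 1`. [folklore] -/
theorem summable_coeff_mul_pow {t : ℤ_[p]} (ht : ‖t‖ < 1) (g : PowerSeries ℤ_[p]) :
    Summable fun k ↦ coeff k g * t ^ k :=
  (summable_norm_coeff_mul_pow ht g).of_norm

/-- **Values multiply**: `(g·h)(t) = g(t)·h(t)` on the open disc (Cauchy product of absolutely summable series). [folklore] -/
theorem evalAt_mul {t : ℤ_[p]} (ht : ‖t‖ < 1) (g h : PowerSeries ℤ_[p]) :
    evalAt t (g * h) = evalAt t g * evalAt t h := by
  unfold evalAt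
  rw [tsum_mul_tsum_eq_tsum_sum_antidiagonal_of_summable_norm (summable_norm_coeff_mul_pow ht g)
    (summable_norm_coeff_mul_pow ht h)]
  refine tsum_congr fun n ↦ ?_
  rw [coeff_mul, Finset.sum_mul]
  refine Finset.sum_congr rfl fun kl hkl ↦ ?_
  have hkl' : kl.1 + kl.2 = n := Finset.HasAntidiagonal.mem_antidiagonal.mp hkl
  rw [← hkl', pow_add]
  ring

/-- **`g(t) ≡ g(0) (mod t)`**: `‖g(t) − g(0)‖ ≤ ‖t‖ < 1`. [folklore] -/
theorem norm_evalAt_sub_constantCoeff_lt_one {t : ℤ_[p]} (ht : ‖t‖ < 1) (g : PowerSeries ℤ_[p]) :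
    ‖evalAt t g - constantCoeff g‖ < 1 := by
  have hs := summable_coeff_mul_pow ht g
  have h0 : evalAt t g = constantCoeff g + ∑' k, coeff (k + 1) g * t ^ (k + 1) := by
    unfold evalAt
    rw [hs.tsum_eq_zero_add]
    simp
  have h1 : ∑' k, coeff (k + 1) g * t ^ (k + 1) = t * ∑' k, coeff (k + 1) g * t ^ k := by
    rw [← (summable_mul_pow ht (fun k ↦ coeff (k + 1) g)).tsum_mul_left t]
    refine tsum_congr fun k ↦ ?_
    ring
  rw [h0, add_sub_cancel_left, h1]
  calc ‖t * ∑' k, coeff (k + 1) g * t ^ k‖ ≤ ‖t‖ * ‖∑' k, coeff (k + 1) g * t ^ k‖ := norm_mul_le _ _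
    _ ≤ ‖t‖ * 1 := by gcongr; exact PadicInt.norm_le_one _
    _ < 1 := by rw [mul_one]; exact ht

/-- Ultrametric bookkeeping: two `p`-adic integers at distance `< 1` are units together. [folklore] -/
theorem norm_eq_one_iff_of_norm_sub_lt_one {x y : ℤ_[p]} (h : ‖x - y‖ < 1) : ‖x‖ = 1 ↔ ‖y‖ = 1 := by
  constructor
  · intro hx
    refine le_antisymm (PadicInt.norm_le_one y) ?_
    by_contra hy
    push Not at hy
    have : ‖x‖ < 1 := by
      calc ‖x‖ = ‖(x - y) + y‖ := by ring_nf
        _ ≤ max ‖x - y‖ ‖y‖ := PadicInt.nonarchimedean _ _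
        _ < 1 := max_lt h hy
    linarith
  · intro hy
    refine le_antisymm (PadicInt.norm_le_one x) ?_
    by_contra hx
    push Not at hx
    have h' : ‖y - x‖ < 1 := by rwa [← norm_neg, neg_sub] at h
    have : ‖y‖ < 1 := by
      calc ‖y‖ = ‖(y - x) + x‖ := by ring_nf
        _ ≤ max ‖y - x‖ ‖x‖ := PadicInt.nonarchimedean _ _
        _ < 1 := max_lt h' hx
    linarith

/-- **`g(t)` is a unit iff `g` is a unit of `Λ`** (for `‖t‖ < 1`). [folklore] -/
theorem isUnit_evalAt_iff {t : ℤ_[p]} (ht : ‖t‖ < 1) (g : PowerSeries ℤ_[p]) :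
    IsUnit (evalAt t g) ↔ IsUnit g := by
  rw [PowerSeries.isUnit_iff_constantCoeff, PadicInt.isUnit_iff, PadicInt.isUnit_iff]
  exact norm_eq_one_iff_of_norm_sub_lt_one (norm_evalAt_sub_constantCoeff_lt_one ht g)

/-- **THE BLIND-POINT LEVER.** `L ∣ ξ` in `ℤ_p⟦T⟧`, `‖t‖ < 1`, `L(t) ≠ 0` and `‖ξ(t)‖ = ‖L(t)‖` ⇒ `(ξ) = (L)`.
(At `p = 2`, `t = −2`: ONE divisibility of the ♯-main conjecture + the blind-point certificate
`#X♯/(T+2)X♯ = ‖L♯(−2)‖⁻¹` ⇒ `char X♯ = (L♯)`.) [folklore] -/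
theorem span_eq_span_of_dvd_of_norm_evalAt_eq {t : ℤ_[p]} (ht : ‖t‖ < 1) {L ξ : PowerSeries ℤ_[p]}
    (hdvd : L ∣ ξ) (hL : evalAt t L ≠ 0) (heq : ‖evalAt t ξ‖ = ‖evalAt t L‖) :
    Ideal.span {ξ} = Ideal.span {L} := by
  obtain ⟨h, rfl⟩ := hdvd
  have hmul := evalAt_mul ht L h
  have hnorm : ‖evalAt t h‖ = 1 := by
    rw [hmul, norm_mul] at heq
    have hL' : ‖evalAt t L‖ ≠ 0 := norm_ne_zero_iff.mpr hL
    field_simp at heq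
    linarith [heq]
  have hunit : IsUnit h := (isUnit_evalAt_iff ht h).mp (PadicInt.isUnit_iff.mpr hnorm)
  exact Ideal.span_singleton_mul_right_unit hunit L

/-- The same lever in valuation language at the blind point `t = −2`, `p = 2` (`‖−2‖₂ = ½ < 1`). [folklore] -/
theorem span_eq_span_of_dvd_of_norm_eval_neg_two_eq {L ξ : PowerSeries ℤ_[2]} (hdvd : L ∣ ξ)
    (hL : evalAt (-2 : ℤ_[2]) L ≠ 0) (heq : ‖evalAt (-2 : ℤ_[2]) ξ‖ = ‖evalAt (-2 : ℤ_[2]) L‖) :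
    Ideal.span {ξ} = Ideal.span {L} := by
  have ht : ‖(-2 : ℤ_[2])‖ < 1 := by
    rw [norm_neg, show (2 : ℤ_[2]) = ((2 : ℕ) : ℤ_[2]) by norm_cast, PadicInt.norm_p]
    norm_num
  exact span_eq_span_of_dvd_of_norm_evalAt_eq ht hdvd hL heq

/-- **Converse bookkeeping (the certificate is also NECESSARY):** if `(ξ) = (L)` then `‖ξ(t)‖ = ‖L(t)‖`. [folklore] -/
theorem norm_evalAt_eq_of_span_eq_span {t : ℤ_[p]} (ht : ‖t‖ < 1) {L ξ : PowerSeries ℤ_[p]}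
    (h : Ideal.span {ξ} = Ideal.span {L}) : ‖evalAt t ξ‖ = ‖evalAt t L‖ := by
  rw [Ideal.span_singleton_eq_span_singleton] at h
  obtain ⟨u, rfl⟩ := h
  rw [evalAt_mul ht, norm_mul]
  have hu : ‖evalAt t (u : PowerSeries ℤ_[p])‖ = 1 :=
    PadicInt.isUnit_iff.mp ((isUnit_evalAt_iff ht _).mpr u.isUnit)
  rw [hu, mul_one]

/-! ## §3. Assembly: one divisibility + the blind certificate ⇒ `BSD(E,2)` in analytic rank 0 -/

section Assembly

open WeierstrassCurve Literature.NumberTheory.EllipticCurves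
  Literature.NumberTheory.EllipticCurves.Rank1Residual
  Literature.NumberTheory.EllipticCurves.Rank1Residual.Typed

/-- Equality of principal ideals gives both divisibilities. [folklore] -/
theorem dvd_and_dvd_of_span_eq_span {R : Type*} [CommRing R] {a b : R}
    (h : Ideal.span {a} = Ideal.span {b}) : a ∣ b ∧ b ∣ a :=
  ⟨Ideal.span_singleton_le_span_singleton.mp h.ge, Ideal.span_singleton_le_span_singleton.mp h.le⟩

/-- **R-L1-G9-α ASSEMBLY (rank 0, `p = 2`).** For a signed Iwasawa datum `D = (ξ, L, c)` at `(E, 2)` with the tree's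
rank-0 readings — (K) Euler characteristic, (P) interpolation with `2 ∤ c`, `E[2]` irreducible, GZK, `L(E,1) ≠ 0` —
ONE divisibility of the signed main conjecture (EITHER side) together with the BLIND-POINT CERTIFICATE
`L(−2) ≠ 0 ∧ ‖ξ(−2)‖₂ = ‖L(−2)‖₂` gives `BSD(E,2)`.  (Intended instance: the ♭-pair, `a₂ = ±2`, `w(E ⊗ χ₈) = +1`, where
`L♭(−2) = (2a₂/5)([1/8]⁺ − [5/8]⁺)` by GEN 9b + packet B and `‖ξ♭(−2)‖⁻¹ = #X♭/(T+2)X♭` is a finite 2-descent quantity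
over `ℚ(√2)` — the (α3) control input, NOT typed here.)  Composition of tree theorems and §2; nothing asserted. [folklore] -/
theorem bsdp_two_of_oneDivisibility_of_blindCertificate (W : WeierstrassCurve ℚ) [W.IsElliptic]
    [W.IsGloballyMinimal] (hGZK : rank_eq_analyticRank_of_analyticRank_le_one)
    (hirr : W.HasIrreducibleModPGaloisRep 2) (hL : W.entireLFunction 1 ≠ 0) (D : SignedDatum W 2)
    (hc : ¬ 2 ∣ D.c) (hK : D.EulerCharacteristic) (hP : D.Interpolation)
    (hdiv : D.LowerDivisibility ∨ D.UpperDivisibility)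
    (hcert0 : evalAt (-2 : ℤ_[2]) D.L ≠ 0)
    (hcert : ‖evalAt (-2 : ℤ_[2]) D.xi‖ = ‖evalAt (-2 : ℤ_[2]) D.L‖) : BSDp W 2 := by
  -- the lever: either divisibility + the certificate ⇒ `(ξ) = (L)`
  have hspan : Ideal.span {D.xi} = Ideal.span {D.L} := by
    rcases hdiv with hlow | hup
    · exact span_eq_span_of_dvd_of_norm_eval_neg_two_eq hlow hcert0 hcert
    · have hxi0 : evalAt (-2 : ℤ_[2]) D.xi ≠ 0 := by
        rw [← norm_ne_zero_iff, hcert, norm_ne_zero_iff]; exact hcert0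
      exact (span_eq_span_of_dvd_of_norm_eval_neg_two_eq hup hxi0 hcert.symm).symm
  obtain ⟨hxiL, hLxi⟩ := dvd_and_dvd_of_span_eq_span hspan
  -- both halves of the missing output, then Miller's `BSD(E,2)`
  have hlow : MissingLowerBoundAt W 2 :=
    missingLowerBoundAt_of_signedLowerDivisibility W 2 hGZK hirr hL D hc hK hP hLxi
  have hup : MissingUpperBoundAt W 2 :=
    missingUpperBoundAt_of_signedUpperDivisibility W 2 hGZK hirr hL D hc hK hP hxiL
  have hr : W.analyticRank = 0 := analyticRank_eq_zero_of_entireLFunction_one_ne_zero W hL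
  exact bsdp_of_missingPPartAt W 2 hGZK (by omega) (missingPPartAt_of_lower_of_upper W 2 hlow hup)

end Assembly

end BlindLever

end Summit.BirchSwinnertonDyer.Rank1Residual.Supersingular
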